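import Summits.HubbardSuperconductivity.HubbardSuperconductivity.Theorems.AnisotropyChordStiffnessNearFar
import Summits.HubbardSuperconductivity.HubbardSuperconductivity.Theorems.AnisotropyChordStiffnessTorusGeometry
import Summits.HubbardSuperconductivity.HubbardSuperconductivity.Theorems.AnisotropyChordStiffnessKernelSymmetric
import Summits.HubbardSuperconductivity.HubbardSuperconductivity.Theorems.AnisotropyChordStiffnessDoubleCommutator

/-!
# Route `AnisotropyChord` / H0 rotor rung: THEOREM TWIST-IR skeleton v10 — every lattice identity and the
# support-counting stub K1′ discharged (theory seat memo ROTOR-THEORY-8 §121–§123)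

With G2–G5 (`AnisotropyChordStiffnessTorusGeometry`), K3 (`filteredKernelSymmetric_holds`), K1′
(`doubleCommutatorBound_holds`), the f-sum rule (`latticeFSumRule_holds`), the continuity equation
(`continuityEquation_holds`) and the scale bookkeeping D5 (`kLipschitzDeficit_of_scale`) all PROVED, the end-to-end
statement reads

`EventualCondensate Δ M ⟸ FarFieldKernelDecay Δ M (K2, Lieb–Robinson)`
`  ∧ GaussianInsertionComparison Δ M (H1′) ∧ UniformHelicityTensor Δ M (S_Υ) ∧ StructureFactorUpper Δ M (S_max)`

on the density window `ρ ∈ (0,1)` with non-empty sectors.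

* `kernelLipschitzAtScale_of_farFieldKernelDecay : FarFieldKernelDecay Δ M → KernelLipschitzAtScale Δ M` (D4 ⟸ K2);
* `kLipschitzDeficit_of_doubleComm_farField`, `kLipschitzDeficit_of_farFieldKernelDecay : FarFieldKernelDecay Δ M →
  KLipschitzDeficit Δ M` (T-DEFICIT ⟸ K2);
* `eventualCondensate_of_farField_skeleton` (v9, K1′ as hypothesis) and
  **`eventualCondensate_of_farFieldKernelDecay`** (v10: BEC ⟸ K2 ∧ H1′ ∧ S_Υ ∧ S_max).
-/

set_option linter.dupNamespace false

noncomputable section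

open Filter Topology
open Literature.MathematicalPhysics.QuantumLattice hiding torusPhase torusNorm
open Literature.Probability.LatticeModels
open Summit.HubbardSuperconductivity.HubbardSuperconductivity.Theorems.AnisotropyChord.InsertionEntropy

namespace Summit.HubbardSuperconductivity.HubbardSuperconductivity.Theorems.AnisotropyChord.Stiffness

/-- **D4 ⟸ K2**: the kernel Lipschitz bound at every scale follows from the far-field kernel decay alone
(G2–G5 and K3 discharged). -/
theorem kernelLipschitzAtScale_of_farFieldKernelDecay (Δ : ℝ) (M : ℕ → ℝ) (hK2 : FarFieldKernelDecay Δ M) :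
    KernelLipschitzAtScale Δ M :=
  kernelLipschitzAtScale_of_farField Δ M phaseLipschitz_holds ballCount_holds farExpSum_holds
    bondCurrentBound_holds hK2 (filteredKernelSymmetric_holds Δ M)

/-- **T-DEFICIT ⟸ K1′ ∧ K2**: the `k`-Lipschitz deficit of the filtered current form from the double-commutator
bound and the far-field kernel decay (D5 `kLipschitzDeficit_of_scale`, K1 ⟸ K1′, D4 ⟸ K2). -/
theorem kLipschitzDeficit_of_doubleComm_farField (Δ : ℝ) (M : ℕ → ℝ) (hK1 : DoubleCommutatorBound Δ M)
    (hK2 : FarFieldKernelDecay Δ M) : KLipschitzDeficit Δ M :=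
  kLipschitzDeficit_of_scale Δ M (firstMomentLocality_of_doubleComm Δ M hK1)
    (kernelLipschitzAtScale_of_farFieldKernelDecay Δ M hK2)

/-- **KERNEL-CHECKED END-TO-END SKELETON v9**: Bose–Einstein condensation of the half-filled-window hard-core
Bose gas (ferromagnetic XXZ, `|Δ| < 1` implicit in the hypotheses) from the two H0-hypothesis-free locality stubs
K1′ `DoubleCommutatorBound` (support counting) and K2 `FarFieldKernelDecay` (Lieb–Robinson), and the three physical
hypotheses H1′ `GaussianInsertionComparison`, S_Υ `UniformHelicityTensor`, S_max `StructureFactorUpper`;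
the f-sum rule, the continuity equation, the kernel symmetry, the torus geometry and the scale bookkeeping are
all discharged. -/
theorem eventualCondensate_of_farField_skeleton (Δ : ℝ) (M : ℕ → ℝ) (ρ : ℝ) (hρ : ρ ∈ Set.Ioo (0 : ℝ) 1)
    (hlim : Tendsto (fun L : ℕ => 1 / 2 + M L / (L : ℝ) ^ 2) atTop (nhds ρ))
    (hsect : ∀ᶠ L : ℕ in atTop, ∀ [NeZero L], spinZSector (Λ := TorusSite 2 L) 1 (M L - 1) ≠ ⊥)
    (hK1 : DoubleCommutatorBound Δ M) (hK2 : FarFieldKernelDecay Δ M)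
    (hG : GaussianInsertionComparison Δ M) (hU : UniformHelicityTensor Δ M)
    (hSmax : StructureFactorUpper Δ M) : EventualCondensate Δ M :=
  eventualCondensate_of_locality_skeleton Δ M ρ hρ hlim hsect (latticeFSumRule_holds Δ) continuityEquation_holds
    hK1 (kernelLipschitzAtScale_of_farFieldKernelDecay Δ M hK2) hG hU hSmax

/-- **T-DEFICIT ⟸ K2 alone**: the `k`-Lipschitz deficit from the far-field kernel decay (K1′ discharged by
`doubleCommutatorBound_holds`). -/
theorem kLipschitzDeficit_of_farFieldKernelDecay (Δ : ℝ) (M : ℕ → ℝ) (hK2 : FarFieldKernelDecay Δ M) :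
    KLipschitzDeficit Δ M :=
  kLipschitzDeficit_of_doubleComm_farField Δ M (doubleCommutatorBound_holds Δ M) hK2

/-- **KERNEL-CHECKED END-TO-END SKELETON v10**: Bose–Einstein condensation of the half-filled-window hard-core Bose gas
from the single H0-hypothesis-free locality stub K2 `FarFieldKernelDecay` (Lieb–Robinson far field of the filtered
current kernel) and the three physical hypotheses H1′ `GaussianInsertionComparison`, S_Υ `UniformHelicityTensor`,
S_max `StructureFactorUpper`; everything else (f-sum rule, continuity equation, kernel symmetry, double-commutator
bound, torus geometry, scale bookkeeping, entropy-route reduction) is a tree theorem. -/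
theorem eventualCondensate_of_farFieldKernelDecay (Δ : ℝ) (M : ℕ → ℝ) (ρ : ℝ) (hρ : ρ ∈ Set.Ioo (0 : ℝ) 1)
    (hlim : Tendsto (fun L : ℕ => 1 / 2 + M L / (L : ℝ) ^ 2) atTop (nhds ρ))
    (hsect : ∀ᶠ L : ℕ in atTop, ∀ [NeZero L], spinZSector (Λ := TorusSite 2 L) 1 (M L - 1) ≠ ⊥)
    (hK2 : FarFieldKernelDecay Δ M)
    (hG : GaussianInsertionComparison Δ M) (hU : UniformHelicityTensor Δ M)
    (hSmax : StructureFactorUpper Δ M) : EventualCondensate Δ M :=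
  eventualCondensate_of_farField_skeleton Δ M ρ hρ hlim hsect (doubleCommutatorBound_holds Δ M) hK2 hG hU hSmax

end Summit.HubbardSuperconductivity.HubbardSuperconductivity.Theorems.AnisotropyChord.Stiffness
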